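import Mathlib
import Summits.MatrixMultiplication.Statement
import Summits.MatrixMultiplication.MatrixMultiplication.Theorems.GraphEquationsServeEngine

/-!
# Graph equations — the serve criterion, easy direction: ALIGNED FUNCTIONALS refute serving (M20d, decomp-mm-lens-5 g33)

(supports `MultiplicityReduction`, stmt-MatrixMultiplication-27806; no new definition.)

The serve engine (M20b) reads `R(⟨n,n,n⟩) ≤ 2N` off constant combinations of program outputs equal
to `f_q` modulo `a⊗b`-free remainders.  Dually (NODE-g33 §3.3): a linear functional `Φ` on the
`a⊗b` coefficients that KILLS the `a⊗b`-shadow of every output while its contraction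
`ψ_{q₀} = Σ_j Φ_{(q₀.1, j),(j, q₀.2)}` is non-zero certifies that NO constant combination of the outputs
serves `q₀` (`not_abServed_of_aligned`).  Over all `q₀` this is an equivalence (finite-dimensional
duality); for word families of vertical fields `Φ` unpacks to an ALIGNED HEAT OPERATOR
`Σ Φ_{IJ} ∂²/∂a_I∂b_J − Σ_q ψ_q ∂/∂F_q` annihilating the tests at the base to finite fibre order.  This
file lands the refutation instrument: an explicit `Φ` (found by linear algebra) certifies that a given
output family — e.g. the AD words of a system along chosen fields at a chosen base — does not serve.
-/

set_option linter.dupNamespace false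

noncomputable section

open scoped BigOperators

namespace Summit.MatrixMultiplication.MatrixMultiplication.Theorems.GraphEquations

open MvPolynomial
open Literature.Computability.AlgebraicComplexity

variable {n : ℕ}

/-- The contraction of a functional on `a⊗b` coefficients against the shadow of `f_{q₀}`:
`Σ_{(i,j),(j',l)} Φ_{(i,j),(j',l)}·[a_{ij}b_{j'l}] f_{q₀} = -Σ_j Φ_{(q₀.1,j),(j,q₀.2)}`. -/
theorem sum_mul_coeff_ab_generator (Φ : Fin n × Fin n → Fin n × Fin n → ℂ) (q₀ : Fin n × Fin n) :
    ∑ ij : Fin n × Fin n, ∑ jl : Fin n × Fin n, Φ ij jl *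
        coeff (Finsupp.single (Sum.inl (Sum.inl ij) : GraphVars n) 1 +
          Finsupp.single (Sum.inl (Sum.inr jl) : GraphVars n) 1) (generator n q₀) =
      -∑ j : Fin n, Φ (q₀.1, j) (j, q₀.2) := by
  classical
  obtain ⟨i₀, l₀⟩ := q₀
  have h1 : ∀ ij jl : Fin n × Fin n,
      Φ ij jl * coeff (Finsupp.single (Sum.inl (Sum.inl ij) : GraphVars n) 1 +
          Finsupp.single (Sum.inl (Sum.inr jl) : GraphVars n) 1) (generator n (i₀, l₀)) =
        -(if ij.2 = jl.1 ∧ ij.1 = i₀ ∧ jl.2 = l₀ then Φ ij jl else 0) := by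
    intro ij jl
    obtain ⟨i, j⟩ := ij
    obtain ⟨j', l⟩ := jl
    rw [coeff_ab_generator (i₀, l₀) i j j' l]
    by_cases hjj : j = j'
    · subst hjj
      by_cases h : (i₀, l₀) = (i, l)
      · obtain ⟨rfl, rfl⟩ := Prod.mk.inj h
        simp
      · have h' : ¬(i = i₀ ∧ l = l₀) := fun hh => h (by rw [hh.1, hh.2])
        simp [h, h']
    · simp [hjj]
  simp_rw [h1, Finset.sum_neg_distrib]
  congr 1
  have hsplit : ∀ f : Fin n × Fin n → ℂ, ∑ x : Fin n × Fin n, f x = ∑ a, ∑ b, f (a, b) :=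
    fun f => Fintype.sum_prod_type f
  rw [hsplit]
  simp_rw [hsplit]
  rw [Finset.sum_eq_single i₀ (fun i _ hi => by simp [hi]) (fun h => absurd (Finset.mem_univ _) h)]
  refine Finset.sum_congr rfl fun j _ => ?_
  rw [Finset.sum_eq_single j (fun j' _ hj' => by simp [Ne.symm hj'])
    (fun h => absurd (Finset.mem_univ _) h)]
  rw [Finset.sum_eq_single l₀ (fun l _ hl => by simp [hl]) (fun h => absurd (Finset.mem_univ _) h)]
  simp

/-- **Aligned functionals refute serving (the easy direction of the alignment criterion).**  If `Φ`
kills the `a⊗b`-shadow of every output `p_o` but `Σ_j Φ_{(q₀.1,j),(j,q₀.2)} ≠ 0`, then no constant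
combination of the `p_o` equals `f_{q₀}` modulo an `a⊗b`-free remainder. -/
theorem not_abServed_of_aligned {ο : Type*} [Fintype ο] (p : ο → MvPolynomial (GraphVars n) ℂ)
    (Φ : Fin n × Fin n → Fin n × Fin n → ℂ)
    (hkill : ∀ o, ∑ ij : Fin n × Fin n, ∑ jl : Fin n × Fin n, Φ ij jl *
        coeff (Finsupp.single (Sum.inl (Sum.inl ij) : GraphVars n) 1 +
          Finsupp.single (Sum.inl (Sum.inr jl) : GraphVars n) 1) (p o) = 0)
    (q₀ : Fin n × Fin n) (hψ : ∑ j : Fin n, Φ (q₀.1, j) (j, q₀.2) ≠ 0) :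
    ¬ ∃ (P : ο → ℂ) (r : MvPolynomial (GraphVars n) ℂ),
        (∀ i j j' l : Fin n,
          coeff (Finsupp.single (Sum.inl (Sum.inl (i, j)) : GraphVars n) 1 +
            Finsupp.single (Sum.inl (Sum.inr (j', l)) : GraphVars n) 1) r = 0) ∧
        ∑ o, C (P o) * p o = generator n q₀ + r := by
  classical
  rintro ⟨P, r, hrab, hserve⟩
  have key : (∑ ij : Fin n × Fin n, ∑ jl : Fin n × Fin n, Φ ij jl *
      coeff (Finsupp.single (Sum.inl (Sum.inl ij) : GraphVars n) 1 +
        Finsupp.single (Sum.inl (Sum.inr jl) : GraphVars n) 1) (∑ o, C (P o) * p o)) =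
      ∑ ij : Fin n × Fin n, ∑ jl : Fin n × Fin n, Φ ij jl *
        coeff (Finsupp.single (Sum.inl (Sum.inl ij) : GraphVars n) 1 +
          Finsupp.single (Sum.inl (Sum.inr jl) : GraphVars n) 1) (generator n q₀ + r) := by
    rw [hserve]
  have hr : ∀ ij jl : Fin n × Fin n,
      coeff (Finsupp.single (Sum.inl (Sum.inl ij) : GraphVars n) 1 +
        Finsupp.single (Sum.inl (Sum.inr jl) : GraphVars n) 1) r = 0 :=
    fun ij jl => hrab ij.1 ij.2 jl.1 jl.2
  simp only [coeff_add, hr, add_zero, sum_mul_coeff_ab_generator, coeff_sum, coeff_C_mul,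
    Finset.mul_sum] at key
  -- the left side vanishes by `hkill`
  have hk : ∀ o, ∑ ij : Fin n × Fin n, ∑ jl : Fin n × Fin n, Φ ij jl * (P o *
      coeff (Finsupp.single (Sum.inl (Sum.inl ij) : GraphVars n) 1 +
        Finsupp.single (Sum.inl (Sum.inr jl) : GraphVars n) 1) (p o)) = 0 := fun o => by
    have := congrArg (fun z : ℂ => P o * z) (hkill o)
    simpa only [Finset.mul_sum, mul_zero, mul_left_comm (P o)] using this
  have hL : ∑ ij : Fin n × Fin n, ∑ jl : Fin n × Fin n, ∑ o, Φ ij jl * (P o *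
      coeff (Finsupp.single (Sum.inl (Sum.inl ij) : GraphVars n) 1 +
        Finsupp.single (Sum.inl (Sum.inr jl) : GraphVars n) 1) (p o)) = 0 := by
    calc ∑ ij : Fin n × Fin n, ∑ jl : Fin n × Fin n, ∑ o, Φ ij jl * (P o *
          coeff (Finsupp.single (Sum.inl (Sum.inl ij) : GraphVars n) 1 +
            Finsupp.single (Sum.inl (Sum.inr jl) : GraphVars n) 1) (p o))
        = ∑ ij : Fin n × Fin n, ∑ o, ∑ jl : Fin n × Fin n, Φ ij jl * (P o *
          coeff (Finsupp.single (Sum.inl (Sum.inl ij) : GraphVars n) 1 +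
            Finsupp.single (Sum.inl (Sum.inr jl) : GraphVars n) 1) (p o)) :=
          Finset.sum_congr rfl fun ij _ => Finset.sum_comm
      _ = ∑ o, ∑ ij : Fin n × Fin n, ∑ jl : Fin n × Fin n, Φ ij jl * (P o *
          coeff (Finsupp.single (Sum.inl (Sum.inl ij) : GraphVars n) 1 +
            Finsupp.single (Sum.inl (Sum.inr jl) : GraphVars n) 1) (p o)) := Finset.sum_comm
      _ = 0 := by simp [hk]
  rw [hL] at key
  exact hψ (neg_eq_zero.mp key.symm)

end Summit.MatrixMultiplication.MatrixMultiplication.Theorems.GraphEquations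

end
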